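import Mathlib
import Literature.Computability.AlgebraicComplexity.StandardFamiliesProofs
import Literature.Computability.AlgebraicComplexity.DeterminantalConormalBoundKernelAlgebra

/-!
# Stub `stub_fanInBelowN` of crux `ChowBorderDepth3.ChowBorderBound` (stmt-ValiantsHypothesis-5936),
# line `registered`: no exact `ΣΠΣ` expression of `perₙ` with top fan-in below `n`

Route `ValiantsHypothesis/ChowBorderDepth3`, crux `ChowBorderBound`, line `registered`, rung C
(the classical `q = 0`, `r < n` slice of the crux along the top-fan-in axis).

**Statement.**  Assume `PermNonvanishing`: replacing the entries of the generic `n × n` matrix at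
fewer than `n` pivot cells `P` by arbitrary polynomials `g` never makes the permanent a constant
`C c`.  Then for `r < n` and every `D`, the generic permanent `perₙ` over `ℂ` is not a sum
`Σ_{i<r} Π_{j<D} ℓ i j` of `r` products of affine forms (`totalDegree (ℓ i j) ≤ 1`).

**Proof** (flag of hyperplane restrictions).  By induction on `r` we prove the stronger claim
`aeval_perPoly_ne_sps_add_C`: if `#P + r < n` and all `m i j` are affine then
`aeval φ perₙ ≠ Σ_{i<r} Π_j m i j + C c`, where `φ v = g v` for `v ∈ P` and `φ v = X v` otherwise
(the `g v` are arbitrary polynomials).  For `r = 0` this is the hypothesis.  For `r + 1`, split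
off the last gate (`Fin.sum_univ_castSucc`).  If all its factors are constants, their product is
a constant `C κ` and the claim for `r` (with constant `κ + c`) applies.  Otherwise some factor
`μ` has a variable `u` with coefficient `b ≠ 0`; the algebra endomorphism `S = aeval f`,
`f u = X u - b⁻¹ μ`, `f w = X w` (`w ≠ u`), kills `μ` (`aeval_eq_zero_of_coeff_ne_zero`), maps
affine forms to affine forms (`totalDegree_aeval_le_one`) and fixes `X w` for `w ≠ u`; hence
`S ∘ aeval φ = aeval φ'` with `φ'` of the same shape for the pivot set `insert u P`
(`#(insert u P) + r < n`), and applying `S` to the identity kills the last gate, so the claim for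
`r` gives the contradiction.  The stub is the case `P = ∅`, `c = 0`.

References: folklore (restriction argument for depth-3 circuits of small top fan-in); the
affine expansion used is `DeterminantalConormal.eq_C_add_sum_of_totalDegree_le_one`.
-/

noncomputable section

-- `Summit.ValiantsHypothesis.ValiantsHypothesis.…` is the tree's mandated single-conjunct layout
-- (Sub = Summit), so the duplicated namespace component is intended.
set_option linter.dupNamespace false

namespace Summit.ValiantsHypothesis.ValiantsHypothesis.Theorems.ChowBorderBound.FanInBelowN

open MvPolynomial Literature.Computability.AlgebraicComplexity

/-! ## Substitutions by affine forms; the substitution killing an affine form -/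

section Kill

variable {K σ : Type*} [Field K]

/-- The substitution `f u = X u - b⁻¹ μ`, `f w = X w` (`w ≠ u`), with `μ` affine and `b` the
coefficient of `X u` in `μ`, is a substitution of affine forms. -/
theorem totalDegree_killFun_le_one {μ : MvPolynomial σ K} (hμ : μ.totalDegree ≤ 1) {u : σ}
    {f : σ → MvPolynomial σ K} (hfu : f u = X u - C (coeff (Finsupp.single u 1) μ)⁻¹ * μ)
    (hfw : ∀ w, w ≠ u → f w = X w) (w : σ) : (f w).totalDegree ≤ 1 := by
  by_cases hw : w = u
  · rw [hw, hfu]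
    refine (totalDegree_sub _ _).trans (max_le (totalDegree_X _).le ?_)
    refine (totalDegree_mul _ _).trans ?_
    rw [totalDegree_C, zero_add]
    exact hμ
  · rw [hfw w hw]
    exact (totalDegree_X _).le

variable [Fintype σ]

/-- A substitution of affine forms for the variables maps affine forms to affine forms. -/
theorem totalDegree_aeval_le_one {f : σ → MvPolynomial σ K} (hf : ∀ w, (f w).totalDegree ≤ 1)
    {p : MvPolynomial σ K} (hp : p.totalDegree ≤ 1) : (aeval f p).totalDegree ≤ 1 := by
  rw [DeterminantalConormal.eq_C_add_sum_of_totalDegree_le_one hp, map_add, map_sum, aeval_C,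
    algebraMap_eq]
  refine (totalDegree_add _ _).trans (max_le ?_ ?_)
  · rw [totalDegree_C]
    exact zero_le_one
  · refine totalDegree_finsetSum_le fun v _ => ?_
    rw [map_mul, aeval_C, algebraMap_eq, aeval_X]
    refine (totalDegree_mul _ _).trans ?_
    rw [totalDegree_C, zero_add]
    exact hf v

/-- The substitution `f u = X u - b⁻¹ μ`, `f w = X w` (`w ≠ u`) kills the affine form `μ` when
the coefficient `b` of `X u` in `μ` is non-zero (restriction to the hyperplane `μ = 0`). -/
theorem aeval_eq_zero_of_coeff_ne_zero {μ : MvPolynomial σ K} (hμ : μ.totalDegree ≤ 1) {u : σ}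
    (hb : coeff (Finsupp.single u 1) μ ≠ 0) {f : σ → MvPolynomial σ K}
    (hfu : f u = X u - C (coeff (Finsupp.single u 1) μ)⁻¹ * μ)
    (hfw : ∀ w, w ≠ u → f w = X w) : aeval f μ = 0 := by
  classical
  -- the `u`-free part `ν` of the affine expansion of `μ`
  obtain ⟨ν, hν⟩ : ∃ ν : MvPolynomial σ K, ν = C (coeff 0 μ) +
      ∑ v ∈ Finset.univ.erase u, C (coeff (Finsupp.single v 1) μ) * X v := ⟨_, rfl⟩
  have hsplit : μ = ν + C (coeff (Finsupp.single u 1) μ) * X u := by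
    rw [hν]
    conv_lhs => rw [DeterminantalConormal.eq_C_add_sum_of_totalDegree_le_one hμ]
    rw [← Finset.add_sum_erase _ _ (Finset.mem_univ u)]
    ring
  have hfix : aeval f ν = ν := by
    rw [hν]
    simp only [map_add, map_sum, map_mul, aeval_C, aeval_X, algebraMap_eq]
    congr 1
    refine Finset.sum_congr rfl fun v hv => ?_
    rw [hfw v (Finset.ne_of_mem_erase hv)]
  calc aeval f μ
      = aeval f (ν + C (coeff (Finsupp.single u 1) μ) * X u) := by rw [← hsplit]
    _ = ν + C (coeff (Finsupp.single u 1) μ) *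
          (X u - C (coeff (Finsupp.single u 1) μ)⁻¹ * μ) := by
        rw [map_add, hfix, map_mul, aeval_C, algebraMap_eq, aeval_X, hfu]
    _ = ν + C (coeff (Finsupp.single u 1) μ) * X u -
          C (coeff (Finsupp.single u 1) μ * (coeff (Finsupp.single u 1) μ)⁻¹) * μ := by
        rw [C_mul]; ring
    _ = 0 := by rw [← hsplit, mul_inv_cancel₀ hb, C_1, one_mul, sub_self]

end Kill

/-! ## The flag-of-restrictions induction -/

/-- **Claim** (induction on the top fan-in `r`).  Under `PermNonvanishing`: if `#P + r < n` and
all `m i j` are affine, then the permanent with the pivot entries `P` replaced by `g` is not of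
the form `Σ_{i<r} Π_j m i j + C c`. -/
theorem aeval_perPoly_ne_sps_add_C
    (hPN : ∀ (n : ℕ) (P : Finset (Fin n × Fin n))
      (g : Fin n × Fin n → MvPolynomial (Fin n × Fin n) ℂ) (c : ℂ), P.card < n →
      MvPolynomial.aeval
          (fun v : Fin n × Fin n =>
            if v ∈ P then g v else (MvPolynomial.X v : MvPolynomial (Fin n × Fin n) ℂ))
          (perPoly (Fin n) ℂ) ≠ MvPolynomial.C c)
    (r : ℕ) :
    ∀ (n D : ℕ) (P : Finset (Fin n × Fin n))
      (g : Fin n × Fin n → MvPolynomial (Fin n × Fin n) ℂ) (c : ℂ)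
      (m : Fin r → Fin D → MvPolynomial (Fin n × Fin n) ℂ),
      P.card + r < n → (∀ i j, (m i j).totalDegree ≤ 1) →
      MvPolynomial.aeval
          (fun v : Fin n × Fin n =>
            if v ∈ P then g v else (MvPolynomial.X v : MvPolynomial (Fin n × Fin n) ℂ))
          (perPoly (Fin n) ℂ) ≠ (∑ i, ∏ j, m i j) + MvPolynomial.C c := by
  induction r with
  | zero =>
    intro n D P g c m hcard _ heq
    rw [Fin.sum_univ_zero, zero_add] at heq
    exact hPN n P g c (by omega) heq
  | succ r ih =>
    intro n D P g c m hcard hm heq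
    rw [Fin.sum_univ_castSucc] at heq
    by_cases hlin : ∃ j u, coeff (Finsupp.single u 1) (m (Fin.last r) j) ≠ 0
    · -- some factor `μ = m (Fin.last r) j₀` of the last gate involves a variable `u`:
      -- restrict to the hyperplane `μ = 0`
      obtain ⟨j₀, u, hb⟩ := hlin
      have hμ : (m (Fin.last r) j₀).totalDegree ≤ 1 := hm _ _
      obtain ⟨f, hfu, hfw⟩ : ∃ f : Fin n × Fin n → MvPolynomial (Fin n × Fin n) ℂ,
          f u = X u - C (coeff (Finsupp.single u 1) (m (Fin.last r) j₀))⁻¹ * m (Fin.last r) j₀ ∧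
            ∀ w, w ≠ u → f w = X w :=
        ⟨fun w => if w = u then
            X u - C (coeff (Finsupp.single u 1) (m (Fin.last r) j₀))⁻¹ * m (Fin.last r) j₀
          else X w, if_pos rfl, fun w hw => if_neg hw⟩
      have hcard' : (insert u P).card + r < n := by
        have := Finset.card_insert_le u P
        omega
      have h0 : ∏ j, aeval f (m (Fin.last r) j) = 0 :=
        Finset.prod_eq_zero (f := fun j => aeval f (m (Fin.last r) j)) (Finset.mem_univ j₀)
          (aeval_eq_zero_of_coeff_ne_zero hμ hb hfu hfw)
      have hcomp : (aeval fun v : Fin n × Fin n =>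
            if v ∈ insert u P then aeval f (if v ∈ P then g v else X v) else X v) =
          (aeval f).comp (aeval fun v : Fin n × Fin n => if v ∈ P then g v else X v) := by
        refine algHom_ext fun v => ?_
        rw [aeval_X, AlgHom.comp_apply, aeval_X]
        by_cases hv : v ∈ insert u P
        · rw [if_pos hv]
        · have hvu : v ≠ u := fun h => hv (by rw [h]; exact Finset.mem_insert_self u P)
          have hvP : v ∉ P := fun h => hv (Finset.mem_insert_of_mem h)
          rw [if_neg hv, if_neg hvP, aeval_X, hfw v hvu]
      have key : aeval (fun v : Fin n × Fin n =>
            if v ∈ insert u P then aeval f (if v ∈ P then g v else X v) else X v)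
            (perPoly (Fin n) ℂ) = (∑ i : Fin r, ∏ j, aeval f (m i.castSucc j)) + C c := by
        rw [hcomp, AlgHom.comp_apply, heq]
        simp only [map_add, map_sum, map_prod, algHom_C, algebraMap_eq]
        rw [h0, add_zero]
      exact ih n D (insert u P) (fun v => aeval f (if v ∈ P then g v else X v)) c
        (fun i j => aeval f (m i.castSucc j)) hcard'
        (fun i j => totalDegree_aeval_le_one (totalDegree_killFun_le_one hμ hfu hfw) (hm _ _))
        key
    · -- every factor of the last gate is a constant: absorb the gate into `C c`
      push Not at hlin
      have hC : ∀ j, m (Fin.last r) j = C (coeff 0 (m (Fin.last r) j)) := fun j => by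
        have e := DeterminantalConormal.eq_C_add_sum_of_totalDegree_le_one (hm (Fin.last r) j)
        have hs : ∑ v, C (coeff (Finsupp.single v 1) (m (Fin.last r) j)) * X v = 0 :=
          Finset.sum_eq_zero fun v _ => by rw [hlin j v, C_0, zero_mul]
        rwa [hs, add_zero] at e
      have hprod : ∏ j, m (Fin.last r) j = C (∏ j, coeff 0 (m (Fin.last r) j)) := by
        rw [map_prod]
        exact Finset.prod_congr rfl fun j _ => hC j
      rw [hprod, add_assoc, ← C_add] at heq
      exact ih n D P g _ (fun i j => m i.castSucc j) (by omega) (fun i j => hm _ _) heq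

/-- **Stub C** (registered stub `stub_fanInBelowN` of crux stmt-ValiantsHypothesis-5936, line
`registered`): `PermNonvanishing` ⟹ `perₙ` has no exact `ΣΠΣ` expression over `ℂ` with top
fan-in `r < n`, for any degree `D`. -/
theorem stub_fanInBelowN :
    (∀ (n : ℕ) (P : Finset (Fin n × Fin n))
      (g : Fin n × Fin n → MvPolynomial (Fin n × Fin n) ℂ) (c : ℂ), P.card < n →
      MvPolynomial.aeval
          (fun v : Fin n × Fin n =>
            if v ∈ P then g v else (MvPolynomial.X v : MvPolynomial (Fin n × Fin n) ℂ))
          (Literature.Computability.AlgebraicComplexity.perPoly (Fin n) ℂ) ≠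
        MvPolynomial.C c) →
    ∀ (n r D : ℕ), r < n → ∀ (ℓ : Fin r → Fin D → MvPolynomial (Fin n × Fin n) ℂ),
      (∀ i j, (ℓ i j).totalDegree ≤ 1) →
      (∑ i, ∏ j, ℓ i j) ≠ Literature.Computability.AlgebraicComplexity.perPoly (Fin n) ℂ := by
  intro hPN n r D hr ℓ hℓ heq
  refine aeval_perPoly_ne_sps_add_C hPN r n D ∅ (fun v => X v) 0 ℓ
    (by rw [Finset.card_empty, zero_add]; exact hr) hℓ ?_
  have hfun : (fun v : Fin n × Fin n =>
      if v ∈ (∅ : Finset (Fin n × Fin n)) then X v else (X v : MvPolynomial (Fin n × Fin n) ℂ)) =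
      X := funext fun v => ite_self _
  rw [hfun, aeval_X_left_apply, C_0, add_zero, heq]

end Summit.ValiantsHypothesis.ValiantsHypothesis.Theorems.ChowBorderBound.FanInBelowN

end
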